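import Literature.InformationTheory.Coding.SourcePolarizationRough

/-!
# Stub `stub_polarizeRough` of line `polarize-to-one-bit-leakage` (crux `SzkEntropy.PeaTwoMemBPP`)

Two-sided ROUGH polarization with a polynomially small unpolarized fraction, uniformly over all
binary sources with functional side information: absolute `μ > 0`, `C` with
`#{j < 2^s : H(U_j | U_{<j}, Y^t) ∈ (2^{-μ s}, 1 − 2^{-μ s})} ≤ C · 2^{(1−μ)s}` — the named fact
`Literature.InformationTheory.Coding.Polar.PolarizeRough` of
`Literature/InformationTheory/Coding/SourcePolarization.lean`, discharged in
`Literature/InformationTheory/Coding/SourcePolarizationRough.lean` (`PolarizeRough_holds`,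
[Arıkan 2010, Thm 1 with Prop. 1–2; Mondelli–Hassani–Urbanke 2016, Lemmas 5–6]); this file only
re-exports it under the registered stub name.
-/

namespace Summit.PneNP.PneNP.Cruxes.PeaTwoMemBPP.PolarizeToOneBitLeakage

set_option linter.dupNamespace false -- Summit.PneNP.PneNP: summit = sub-problem (D-0017)

open Literature.InformationTheory.Coding.Polar

/-- `stub_polarizeRough` of line polarize-to-one-bit-leakage: two-sided rough polarization with a
polynomially small unpolarized fraction — absolute `μ > 0`, `C` with
`#{j < 2^s : H(U_j | U_{<j}, Y^t) ∈ (2^{-μ s}, 1 − 2^{-μ s})} ≤ C · 2^{(1−μ)s}` for EVERY binary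
source with functional side information [Arıkan 2010, Thm 1 + Prop. 1–2, with the universal
polynomial rate of rough polarization (Mondelli–Hassani–Urbanke 2016, Lemmas 5–6)]. -/
theorem stub_polarizeRough : PolarizeRough :=
  PolarizeRough_holds

end Summit.PneNP.PneNP.Cruxes.PeaTwoMemBPP.PolarizeToOneBitLeakage
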